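import Summits.HodgeConjecture.HodgeConjecture.Theses.GaloisSieve
import Summits.HodgeConjecture.HodgeConjecture.Theorems.PadicSemiregularLiftHodgeFermatVarietiesLatticeCriterion
import Summits.HodgeConjecture.HodgeConjecture.Theorems.PadicSemiregularLiftHodgeFermatVarietiesPrintedSupply
import Summits.HodgeConjecture.HodgeConjecture.Theorems.PadicSemiregularLiftHodgeFermatVarietiesLevelRaise
import Summits.HodgeConjecture.HodgeConjecture.Theorems.PadicSemiregularLiftHodgeFermatVarietiesStubClaimLevelPushHolds
import Summits.HodgeConjecture.HodgeConjecture.Theorems.PadicSemiregularLiftHodgeFermatVarietiesStubClaimLevelPullFacts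
import Literature.AlgebraicGeometry.HodgeTheory.FermatFourfoldSemiDecomposableEigenlines
import Literature.AlgebraicGeometry.HodgeTheory.ShiodaClaimPairedOfJuxtaposition
import Literature.AlgebraicGeometry.HodgeTheory.FermatDiagonalAction

/-!
# Line `stable-reach-recut` for the crux `CosetAlgebraicity` (stmt-HodgeConjecture-14561), route `GaloisSieve`
# — "(P)-irreducible Hodge characters on Hodge lines are STABLY ℤ-REACHABLE from the printed supply;
#    the sign classes are isolated"

An ALTERNATIVE line to `Lines/birth.lean` (crux-strategist, 2026-08-17). The crux (rank 2 of the route):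

  for every `p ≥ 2`, every level `m` and every INDECOMPOSABLE Hodge character `α : Fin (2p+2) → ℤ/m`
  lying ON A HODGE LINE, the eigenline `V(α) ⊂ H²ᵖ(X²ᵖₘ(ℂ); ℂ)` (spelled inline) is algebraic.

## The transfer

The solved-sibling technology is the LANDED lattice calculus of the crux `HodgeFermatVarieties`
(stmt-HodgeConjecture-1334, route `PadicSemiregularLift`, line `cancel-by-any-claim-lattice`): Aoki 1987
Thm 1-4 (i)+(ii) make "claim" closed under the GROUP law of Shioda's semigroup `Mₘ` modulo the printed
supply (`stub_latticeCriterion`, landed), the printed supply (pairs, Hodge 4-sets, semi-decomposable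
sextuples, Aoki's standard elements `σ_{p,a}`) consists of claimed multisets (`stub_printedSupply`,
landed), and claim moves along the level map `[xᵢ] ↦ [xᵢᵏ]` (`stub_claimLevelPush`, landed
unconditionally; `stub_claimLevelPull_of_facts`, from Fulton + Bredon). Hence every STABLY REACHABLE
Hodge multiset (`StableReach[m, s]`: `k • s + ΣN = ΣP` at some level `km`, `P`, `N` supply families)
is claimed, modulo printed theorems only. In that calculus Shioda's whole `(Pₘ)`-reduction is FREE:
decomposable and quasi-decomposable characters are lattice combinations of strictly shorter ones and a
pair, so by strong induction on the length the only characters that are NOT settled by shorter ones are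
the `(P)`-IRREDUCIBLE ones (neither decomposable, nor quasi-, nor semi-decomposable), and among those
the stably reachable ones are settled by the supply. This cuts the crux as follows:

* STUB A `stub_irreducibleOnLine_stableReach` (NEW, PURELY ARITHMETIC — the line's own content):
  every `(P)`-irreducible Hodge character of length `2p+2 ≥ 6` lying on a Hodge line is stably
  ℤ-reachable from the printed supply. Equivalently: the Yamamoto–Aoki SIGN CLASSES (the residual
  `ℤ/2` per bad degree of the sibling's census, `K_Hodge(m)/L_D(m) ∈ {0, ℤ/2}` for all `m ≤ 160`) have
  NO `(P)`-irreducible representative on a Hodge line. Evidence (strategist folder `calc/hodgeline.py`,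
  exact): EVERY known minimal sign-class representative is `(P)`-irreducible AND CERTIFIED ISOLATED —
  `gap₃₅ = (1,2,16,17,21,22,30,31)/35` (single-prime certificate `ℓ = 3`), `gap₄₄ =
  (1,4,5,13,33,37,41,42)/44` (`ℓ = 3`), the fourfold classes `(1,20,24,42,61,62)/70` (`ℓ = 3`),
  `(1,24,62,71,81,91)/110`, `(1,31,55,71,81,91)/110` (`ℓ = 3`), the three `X⁴₁₁₄` sextuples (`ℓ = 5`),
  and da Silva's `(1,4,16,22,25,31)/33` (`ℓ = 5`; this one IS stably reachable, `k = 2`); and at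
  `p = 2` every Hodge sextuple ON A LINE of every level `4 ≤ m ≤ 120` is reachable at its own level
  (idea-node census FourfoldReach-census.md on stmt-14562: the only unreachable sextuples live at
  `33, 70, 99, 110, 114`, all isolated). Why easier than STUB 3 of `birth` (`(P)`-irreducible on a line
  ⇒ ALGEBRAIC): no cohomology — a statement about torsion points of the character torus versus an
  explicit lattice, decidable level by level (kit censuses), and open to Aoki's character-sum technology
  already in the tree (Thm A `PairedOfLargePrimesSharp`, the `5q`/`pq`/coprime-6 classifications) and to
  the route's own layer-2 plan `LineTypes` (a line is a balanced speed configuration; `p = 1`: on-line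
  indecomposable = standard element, Aoki–Shioda Theorem (𝔅²ₘ) (ii), which IS "on a line ⇒ supply").
* STUB B `stub_irreducibleIsolated_residual` (open HC — the genuinely sporadic content, NOT the crux's):
  a `(P)`-irreducible ISOLATED Hodge character of length `2p+2 ≥ 6` that is NOT stably reachable has an
  algebraic eigenline. This is VERBATIM a sub-family of the route's rank-3 crux `SporadicAlgebraicity`
  (`stubB_of_sporadicAlgebraicity` below, one line) and, modulo the printed facts, the same open
  mathematics as the sibling's engine stub `stub_residualSignClasses_core` (first decisive instance the
  sixfold eigenline `V(gap₃₅) ⊂ H⁶(X⁶₃₅)`; Das 2000 barrier: no cycle over the classical fields).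
* STUB S0 `stub_printedFacts` (literature debt, research risk nil): the seven printed theorems the
  landed calculus consumes, as the tree's named facts (Aoki 1987 Thm 1-4 (i), (ii), Thm 2-1;
  Aoki–Shioda 1983 (2.1); Shioda 1979 semi-decomposable sextuples; Fulton Cor. 19.2 (b); Bredon
  II.19.2) — conjuncts 1–7 of the sibling's S0, so one discharge closes both.

COMPOSITION (kernel-checked, no `sorry`): `claimMultiset_of_stubs` — strong induction on the
cardinality over ALL non-empty Hodge multisets of a level (pairs: dimension 0; 4-sets: the surface
fact; decomposable / quasi-decomposable: the landed lattice criterion fed the induction hypothesis —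
da Silva's remark "quasi-decomposable ⇒ (P1) or (P2)" made precise exactly as in the tree's
`IsShiodaClosed.of_shiodaConditionUpTo`; semi-decomposable: the fact; `(P)`-irreducible on a line:
STUB A + `claimMultiset_of_stableReach`; `(P)`-irreducible isolated: stably reachable ⇒ the same, else
STUB B) — then `CosetAlgebraicity_of` through the bridge `eigInline_iff` (inline eigenline clause ↔
`c ∈ fermatEigenspace m α (2p)`). By-products recorded here: the line proves the route's TARGET
`HodgeEigenlines` from the same three stubs (`hodgeEigenlines_of_stubs`), and
`CosetAlgebraicity` follows from `SporadicAlgebraicity` + STUB A + S0 (`cosetAlgebraicity_of_sporadic`):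
the rank-2 crux costs NOTHING beyond the rank-3 crux except the arithmetic STUB A and printed theorems.

Why it dodges the stuck point of `birth`: `birth`'s STUB 2 (quasi-decomposable indecomposable ON-LINE
characters are algebraic, stated ABSOLUTELY) provably contains the sporadic sign classes (the route
review's absorption `γ = Nc ∗ (η ∗_d αᵢ)`: e.g. the on-line `γ₇₀` built on `(1,20,24,42,61,62)/70`
carries the level-70 sign class = `2 • gap₃₅`), so no lead can close it short of the sister crux; here
the quasi-decomposable case is discharged by Aoki 1-4 (i)+(ii) and the induction hypothesis, and the
sporadic content is named honestly (STUB B ⊆ SporadicAlgebraicity). `birth`'s STUB 3 (`(P)`-irreducible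
on a line ⇒ algebraic) is implied by STUB A + S0 (`birthStub3_of_stubs`).

Disproof used: none on file for this crux (`ledger crux ls stmt-HodgeConjecture-14561`: Lines/birth.*
only; no `Disproof.lean`, no `_false_without_`, no landed Negative lemma). Honoured from the sibling's
Disproof (Cruxes/HodgeFermatVarieties/Disproof.lean, read 2026-08-17): §7
`exists_levelCalculusClosed_not_daSilva33` (the calculus OF ONE LEVEL does not reach da Silva's class)
— STUB A asks for STABLE reachability (`∃ k`), never reachability at the own level; the DEATH TABLE
(`gap₃₅`, `gap₄₄`, `s₀ ∈ ℤ/110` survive every tested level raising) — these classes are CERTIFIED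
ISOLATED (above), so they are instances of STUB B's hypothesis, never asserted reachable; negatives
index (`DerivedTorelliFermat.K3Exhaustion_refuted`, witness `{1,24,62,71,81,91}/110`): isolated, same
remark. Landed Negative `HodgeFermatVarieties/Negative/NotReachThirtyThree`: level 33 only, same remark.
-/

set_option linter.dupNamespace false

noncomputable section

namespace Summit.HodgeConjecture.HodgeConjecture.Cruxes.CosetAlgebraicity.StableReachRecut

open Finset
open Literature.AlgebraicGeometry.Motives Literature.AlgebraicGeometry.HodgeTheory
  Literature.AlgebraicGeometry.HodgeTheory.FermatCharacter
  Literature.AlgebraicTopology.SingularHomology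
open Summit.HodgeConjecture.HodgeConjecture.Theses.GaloisSieve (CosetAlgebraicity SporadicAlgebraicity
  HodgeEigenlines)
open Summit.HodgeConjecture.HodgeConjecture.Theorems.CancelByAnyClaimLattice (stub_latticeCriterion
  stub_printedSupply isHodgeMultiset_levelRaise claimMultiset_levelRaise_iff_of_pull_push
  stub_claimLevelPush stub_claimLevelPull_of_facts latticeCriterion_isHodgeMultiset_map_neg)

/-! ### Vocabulary — the sibling line's LOCAL NOTATIONS, verbatim (they expand to closed terms over
`IsHodgeMultiset` / `IsSemiDecomposable`; a stub worker copies these four lines) -/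

/-- `Supply[M]` — the printed supply of level `M` (pairs, Hodge 4-multisets, semi-decomposable Hodge
sextuples, Aoki's standard elements under Aoki's side condition). Local notation only, verbatim from
`Cruxes/HodgeFermatVarieties/Lines/cancel_by_any_claim_lattice.lean`. -/
local notation3 (prettyPrint := false) "Supply[" M "]" =>
  ({s : Multiset (ZMod M) | ∃ a : ZMod M, a ≠ 0 ∧ s = ({a, -a} : Multiset (ZMod M))} ∪
    {s : Multiset (ZMod M) | IsHodgeMultiset s ∧ Multiset.card s = 4} ∪
    {s : Multiset (ZMod M) | IsHodgeMultiset s ∧ IsSemiDecomposable s} ∪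
    {s : Multiset (ZMod M) | ∃ (p : ℕ) (a : ZMod M), p.Prime ∧ p ≠ 2 ∧ p ∣ M ∧
        2 < (M / p) / Nat.gcd (ZMod.val a) (M / p) ∧
        s = Multiset.map (fun j : ℕ => a + (j : ZMod M) * ((M / p : ℕ) : ZMod M)) (Multiset.range p) +
              {-((p : ZMod M) * a)}} : Set (Multiset (ZMod M)))

/-- `Reach[M, s]` — ℤ-reachability from the supply of level `M`. Local notation only, verbatim. -/
local notation3 (prettyPrint := false) "Reach[" M ", " s "]" =>
  ∃ P N : Multiset (Multiset (ZMod M)),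
    (∀ u ∈ P, u ∈ Supply[M]) ∧ (∀ u ∈ N, u ∈ Supply[M]) ∧ s + Multiset.sum N = Multiset.sum P

/-- `LevelRaise[k, m, s]` — level raising `s ↦ k • s`. Local notation only, verbatim. -/
local notation3 (prettyPrint := false) "LevelRaise[" k ", " m ", " s "]" =>
  Multiset.map (fun a : ZMod m => ((k * ZMod.val a : ℕ) : ZMod (k * m))) s

/-- `StableReach[m, s]` — reachable after SOME level raising `k ≥ 1`. Local notation only, verbatim. -/
local notation3 (prettyPrint := false) "StableReach[" m ", " s "]" =>
  ∃ k : ℕ, 0 < k ∧ Reach[k * m, LevelRaise[k, m, s]]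

/-! ### The eigenline clause of the route items -/

/-- **`V(α) ⊆ algebraicClasses`** for `α : Fin (2p+2) → ℤ/m` on the Fermat `2p`-fold of degree `m` —
the inline clause of the route items VERBATIM (`cosetAlgebraicity_iff` is `Iff.rfl`).
[cite: Shioda1979HodgeFermat, §1] -/
def EigenlineAlgebraic (p m : ℕ) (α : Fin (2 * p + 2) → ZMod m) : Prop :=
  ∀ c : complexBetti (SmoothHypersurface.hypersurface (fermatPolynomial ℂ (2 * p) m)) (2 * p),
    (∀ (a : Fin (2 * p + 2) → ℂˣ) (ha : a ∈ diagonalStabilizer (fermatPolynomial ℂ (2 * p) m)),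
      (∀ i, a i ^ m = 1) →
        singularCohomology.map ℂ ℂ (diagonalMap (fermatPolynomial ℂ (2 * p) m) ha) (2 * p) c =
          (∏ i, ((a i : ℂˣ) : ℂ) ^ (α i).val) • c) →
    c ∈ algebraicClasses (SmoothHypersurface.hypersurface (fermatPolynomial ℂ (2 * p) m)) p

/-- The crux read through `EigenlineAlgebraic` (`Iff.rfl`). [folklore] -/
theorem cosetAlgebraicity_iff :
    CosetAlgebraicity ↔
      ∀ (p m : ℕ) [NeZero m] (α : Fin (2 * p + 2) → ZMod m), 2 ≤ p → IsHodge α →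
        ¬ IsDecomposable (univ.val.map α) → OnHodgeLine α → EigenlineAlgebraic p m α :=
  Iff.rfl

/-- The route's target read through `EigenlineAlgebraic` (`Iff.rfl`). [folklore] -/
theorem hodgeEigenlines_iff :
    HodgeEigenlines ↔
      ∀ (p m : ℕ) [NeZero m] (α : Fin (2 * p + 2) → ZMod m), 0 < p → IsHodge α →
        EigenlineAlgebraic p m α :=
  Iff.rfl

/-! ### The three registered stubs -/

/-- **STUB S0 `stub_printedFacts` — the line's entire LITERATURE DEBT: seven printed theorems as the
tree's named facts** (= conjuncts 1–7 of the sibling skeleton's `stub_printedFacts`, crux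
`HodgeFermatVarieties`, so one discharge closes both; research risk nil): Aoki 1987 Thm 1-4 (i)
juxtaposition, Thm 1-4 (ii) pair cancellation, Thm 2-1 `p`-standard subvarieties; Aoki–Shioda 1983
(2.1) (Hodge eigenlines of the Fermat surface are algebraic); Shioda 1979's semi-decomposable
sextuples; Fulton, *Intersection Theory* Cor. 19.2 (b) (pull-back of algebraic classes); Bredon,
*Sheaf Theory* II.19.2 (cohomology of a finite quotient = invariants). Why it might fail: it cannot in
print; in the tree each conjunct is formalisation debt (inductive structure / cycle classes on the real
carriers), proof files in progress: `FermatJuxtapositionGysin`, `FermatClaimPairedCancellation`,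
`FermatAokiClaimPStandardLeaves`, `FermatSurfaceNeronSeveriEigenlinesProofs`,
`FermatFourfoldSemiDecomposableEigenlinesProofs`, `AlgebraicClassesPullback`, `FiniteQuotientInvariants`.
[cite: Aoki1987, Thm. 1-4 (i), (ii) and Thm. 2-1, p. 388] [cite: AokiShioda1983, §2 (2.1)]
[cite: Shioda1979PJA, §1 Definition (iii) and §4] [cite: Fulton1998, Cor. 19.2 (b)] [cite: Bredon1997, II.19.2] -/
theorem stub_printedFacts :
    Aoki1987_claim_juxtaposition ∧ Aoki1987_claim_of_claim_juxtaposition_paired ∧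
      Aoki1987_claim_pStandard ∧ AokiShioda1983_eigenline_le_neronSeveri ∧
      Shioda1979_claim_semiDecomposable ∧ fulton1998_map_mem_algebraicClasses ∧
      bredon1997_quotient_cohomology_invariants := by
  sorry

/-- **STUB A `stub_irreducibleOnLine_stableReach` — `(P)`-IRREDUCIBLE HODGE CHARACTERS ON HODGE LINES
ARE STABLY ℤ-REACHABLE FROM THE PRINTED SUPPLY** (NEW; purely arithmetic; the line's load-bearing own
content). For `p ≥ 2`, every level `m ≥ 1` and every Hodge character `α : Fin (2p+2) → ℤ/m` which is
neither decomposable, nor quasi-decomposable, nor semi-decomposable (Shioda `(P)`-irreducible: the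
elements where `(Pₘ)` fails) and lies on a Hodge line, there is `k ≥ 1` such that `k • {α}` plus a sum
of supply elements of level `km` is a sum of supply elements of level `km`. Equivalently ("sign classes
are isolated"): no residual class of the quotient `K_Hodge/⟨stable supply⟩` has a `(P)`-irreducible
on-line representative. Evidence: every known minimal residual representative (`gap₃₅`, `gap₄₄`, the
fourfold classes of `ℤ/70`, `ℤ/110`, `ℤ/114`) is `(P)`-irreducible and CERTIFIED ISOLATED (strategist
calc/hodgeline.py, single-prime certificates `ℓ ∈ {3, 5}`); at `p = 2` every on-line Hodge sextuple of
every level `4 ≤ m ≤ 120` is reachable at its own level (idea-node exact census on stmt-14562); at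
`p = 1` the analogue is Aoki–Shioda's Theorem (𝔅²ₘ) (ii) (indecomposable on a line = standard element
= supply). Why it might fail: a `(P)`-irreducible on-line character carrying a sign class at some
level with two small primes (first place to look: octuples of `ℤ/35k`, `ℤ/44k`, 10-tuples of `ℤ/51`,
`ℤ/55`) — decidable by census; one such character kills THIS LINE (not the crux). Leans on:
`IsDecomposable/IsQuasiDecomposable/IsSemiDecomposable`, `OnHodgeLine` (+ `.unitSMul/.inflate`),
the sibling's `Supply/Reach/StableReach` calculus (`Doubling`, `ReachStd`, `PairedOfLargePrimesSharp`).
[cite: AokiShioda1983, §2 Theorem (𝔅²ₘ) (ii)] [cite: Aoki1987, Thm. 1-4 and Thm. 2-1]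
[cite: Aoki2002, Thm. 3.1 (the gap group B_m/S_m)] [cite: daSilva2021HodgeFermat, Prop. 3.6] -/
theorem stub_irreducibleOnLine_stableReach :
    ∀ (p m : ℕ) [NeZero m] (α : Fin (2 * p + 2) → ZMod m), 2 ≤ p → FermatCharacter.IsHodge α →
      ¬ FermatCharacter.IsDecomposable (Finset.univ.val.map α) →
      ¬ FermatCharacter.IsQuasiDecomposable (Finset.univ.val.map α) →
      ¬ FermatCharacter.IsSemiDecomposable (Finset.univ.val.map α) →
      FermatCharacter.OnHodgeLine α →
        StableReach[m, Finset.univ.val.map α] := by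
  sorry

/-- **STUB B `stub_irreducibleIsolated_residual` — THE RESIDUAL SPORADIC CLASSES ARE ALGEBRAIC** (open
HC; verbatim a SUB-FAMILY of the route's rank-3 crux `SporadicAlgebraicity`, see
`stubB_of_sporadicAlgebraicity`; modulo S0 the same open mathematics as the sibling's engine
`stub_residualSignClasses_core`). For `p ≥ 2`, every level `m ≥ 1` and every `(P)`-irreducible Hodge
character `α : Fin (2p+2) → ℤ/m` lying on NO Hodge line and NOT stably reachable from the printed
supply, the eigenline `V(α) ⊂ H²ᵖ(X²ᵖₘ(ℂ); ℂ)` (inline clause of the route items) is algebraic. First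
instances (sibling census + DEATH TABLE, all certified isolated here): `V(gap₃₅) ⊂ H⁶(X⁶₃₅)`,
`V(gap₄₄) ⊂ H⁶(X⁶₄₄)`, `V(1,20,24,42,61,62) ⊂ H⁴(X⁴₇₀)`, the `X⁴₁₁₀`/`X⁴₁₁₄` sextuples — ONE class
per residual `ℤ/2`-coset suffices (lattice criterion). Why it might fail: each is a CM Hodge class with
no cycle over the classical fields `ℚ(ζ_{2m}, p^{1/d})` (Das 2000: the Γ-monomials of gap elements
generate non-abelian extensions); a genuinely new cycle or engine is needed (on file: p-adic
semiregular seeds of `PadicSemiregularLift`, GHC in coniveau 1 for `(1,21,22,30,31) ⊂ H³(X³₃₅)`,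
Weil-family deformation); one non-algebraic instance refutes HC. Size XL (open).
[cite: Aoki2002, Thm. 3.1 and Thm. 9.2] [cite: daSilva2021HodgeFermat, Question 1]
[cite: Aoki1987, Thm. 1-4] [cite: Das2000, Thm. 1] -/
theorem stub_irreducibleIsolated_residual :
    ∀ (p m : ℕ) [NeZero m] (α : Fin (2 * p + 2) → ZMod m), 2 ≤ p → FermatCharacter.IsHodge α →
      ¬ FermatCharacter.IsDecomposable (Finset.univ.val.map α) →
      ¬ FermatCharacter.IsQuasiDecomposable (Finset.univ.val.map α) →
      ¬ FermatCharacter.IsSemiDecomposable (Finset.univ.val.map α) →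
      ¬ FermatCharacter.OnHodgeLine α →
      ¬ StableReach[m, Finset.univ.val.map α] →
      ∀ c : complexBetti (SmoothHypersurface.hypersurface (fermatPolynomial ℂ (2 * p) m)) (2 * p),
        (∀ (a : Fin (2 * p + 2) → ℂˣ) (ha : a ∈ diagonalStabilizer (fermatPolynomial ℂ (2 * p) m)),
          (∀ i, a i ^ m = 1) →
            singularCohomology.map ℂ ℂ (diagonalMap (fermatPolynomial ℂ (2 * p) m) ha) (2 * p) c =
              (∏ i, ((a i : ℂˣ) : ℂ) ^ (α i).val) • c) →
        c ∈ algebraicClasses (SmoothHypersurface.hypersurface (fermatPolynomial ℂ (2 * p) m)) p := by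
  sorry

/-! ### The bridge: the inline eigenline clause is membership in `fermatEigenspace` -/

/-- **The inline eigenvector clause of the route items is `c ∈ V(α)`** (`fermatEigenspace m α k`):
`μₘⁿ⁺² = {a | aᵢᵐ = 1}` (`mem_fermatGroup_iff`), it fixes the Fermat form
(`fermatGroup_le_diagonalStabilizer`; the two proofs of `a ∈ diagonalStabilizer` are equal), and
`χ_α(a) = ∏ aᵢ^{⟨αᵢ⟩}` (`fermatCharacter_apply`). [cite: Shioda1979PJA, §4] -/
theorem eigInline_iff {n m : ℕ} {α : Fin (n + 2) → ZMod m} {k : ℕ}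
    {c : complexBetti (SmoothHypersurface.hypersurface (fermatPolynomial ℂ n m)) k} :
    (∀ (a : Fin (n + 2) → ℂˣ) (ha : a ∈ diagonalStabilizer (fermatPolynomial ℂ n m)),
      (∀ i, a i ^ m = 1) →
        singularCohomology.map ℂ ℂ (diagonalMap (fermatPolynomial ℂ n m) ha) k c =
          (∏ i, ((a i : ℂˣ) : ℂ) ^ (α i).val) • c) ↔
      c ∈ fermatEigenspace m α k := by
  have hprod : ∀ a : fermatGroup n m,
      ((fermatCharacter m α a : ℂˣ) : ℂ) = ∏ i, (((a : Fin (n + 2) → ℂˣ) i : ℂˣ) : ℂ) ^ (α i).val := by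
    intro a
    rw [fermatCharacter_apply]
    push_cast
    rfl
  rw [mem_fermatEigenspace_iff]
  constructor
  · intro h a
    rw [hprod]
    exact h (a : Fin (n + 2) → ℂˣ) (fermatGroup_le_diagonalStabilizer m a.2) (mem_fermatGroup_iff.mp a.2)
  · intro h a ha hm
    have h1 := h ⟨a, mem_fermatGroup_iff.mpr hm⟩
    rw [hprod] at h1
    exact h1

/-- `EigenlineAlgebraic p m α ↔ claim(α)` (`FermatCharacter.Claim m p α`:
`V(α) ≤ algebraicClasses (fermatHypersurface (2p) m) p`; `fermatHypersurface` is an `abbrev` of the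
standard model). [cite: Aoki1987, Introduction p. 385 (CLAIM(α))] -/
theorem eigenlineAlgebraic_iff_claim {p m : ℕ} {α : Fin (2 * p + 2) → ZMod m} :
    EigenlineAlgebraic p m α ↔ FermatCharacter.Claim m p α := by
  constructor
  · intro h c hc
    exact h c (eigInline_iff.mpr hc)
  · intro h c hc
    exact h (eigInline_iff.mp hc)

/-! ### The landed calculus, assembled from the facts of S0 -/

section Calculus

/-- The facts of S0, as a hypothesis of the sorry-free glue below. -/
def Facts : Prop :=
  Aoki1987_claim_juxtaposition ∧ Aoki1987_claim_of_claim_juxtaposition_paired ∧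
    Aoki1987_claim_pStandard ∧ AokiShioda1983_eigenline_le_neronSeveri ∧
    Shioda1979_claim_semiDecomposable ∧ fulton1998_map_mem_algebraicClasses ∧
    bredon1997_quotient_cohomology_invariants

variable (hF : Facts)
include hF

/-- **Level change of claim, both ways** (from Fulton + Bredon via the sibling's landed
`stub_claimLevelPull_of_facts`, and the unconditionally landed `stub_claimLevelPush`), in the multiset
spelling the landed `stub_printedSupply` consumes. [cite: ShiodaKatsura1979, §1] [cite: Aoki1987, Cor. 2-3] -/
theorem levelChange :
    ∀ (m k : ℕ) [NeZero m], 0 < k → ∀ s : Multiset (ZMod m), s ≠ 0 → IsHodgeMultiset s →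
      IsHodgeMultiset (LevelRaise[k, m, s]) ∧
        (ClaimMultiset m s ↔ ClaimMultiset (k * m) (LevelRaise[k, m, s])) :=
  fun m k _ hk s hs0 hs ↦
    ⟨isHodgeMultiset_levelRaise m k hk s hs0 hs,
      claimMultiset_levelRaise_iff_of_pull_push
        (stub_claimLevelPull_of_facts hF.2.2.2.2.2.1 hF.2.2.2.2.2.2) stub_claimLevelPush m k hk s hs0 hs⟩

/-- **The printed supply of every level consists of non-empty Hodge multisets claimed together with
their negations** (the sibling's landed S3b fed S0). [cite: Aoki1987, Thm. 1-1, Thm. 2-1] [cite: AokiShioda1983, §2 (2.1)] -/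
theorem supply_claimed :
    ∀ (M : ℕ) [NeZero M], ∀ u ∈ Supply[M],
      u ≠ 0 ∧ IsHodgeMultiset u ∧ ClaimMultiset M u ∧ ClaimMultiset M (u.map fun a ↦ -a) :=
  stub_printedSupply (Shioda_claim_paired_of_juxtaposition hF.1) hF.2.2.2.1 hF.2.2.1
    (Shioda1979_claim_semiDecomposable_iff_multiset.1 hF.2.2.2.2.1) (levelChange hF)

/-- **The lattice criterion with the MAXIMAL admissible family** `D = {u ≠ 0 Hodge, claimed with its
negation}`: `s + ΣN = ΣP` with `P`, `N ⊆ D` ⟹ claim(`s`). [cite: Aoki1987, Thm. 1-4 (i), (ii)] -/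
theorem claim_of_rel {M : ℕ} [NeZero M] {s : Multiset (ZMod M)} (hs0 : s ≠ 0) (hs : IsHodgeMultiset s)
    (P N : Multiset (Multiset (ZMod M)))
    (hP : ∀ u ∈ P, u ≠ 0 ∧ IsHodgeMultiset u ∧ ClaimMultiset M u ∧ ClaimMultiset M (u.map fun a ↦ -a))
    (hN : ∀ u ∈ N, u ≠ 0 ∧ IsHodgeMultiset u ∧ ClaimMultiset M u ∧ ClaimMultiset M (u.map fun a ↦ -a))
    (heq : s + N.sum = P.sum) : ClaimMultiset M s :=
  stub_latticeCriterion hF.1 hF.2.1 M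
    {u | u ≠ 0 ∧ IsHodgeMultiset u ∧ ClaimMultiset M u ∧ ClaimMultiset M (u.map fun a ↦ -a)}
    (fun _ hu ↦ hu) s P N hs0 hs hP hN heq

/-- **Reachable ⟹ claimed** (own level). [cite: Aoki1987, Thm. 1-4 (i), (ii)] -/
theorem claim_of_reach {M : ℕ} [NeZero M] {s : Multiset (ZMod M)} (hs0 : s ≠ 0) (hs : IsHodgeMultiset s)
    (h : Reach[M, s]) : ClaimMultiset M s := by
  obtain ⟨P, N, hP, hN, heq⟩ := h
  exact claim_of_rel hF hs0 hs P N (fun u hu ↦ supply_claimed hF M u (hP u hu))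
    (fun u hu ↦ supply_claimed hF M u (hN u hu)) heq

/-- **Stably reachable ⟹ claimed**: raise to level `km`, apply the criterion there, descend by the level
change. (The sibling skeleton's `claimMultiset_of_stableReach`, re-assembled from landed files.)
[cite: Aoki1987, Thm. 1-4 and Cor. 2-3] [cite: ShiodaKatsura1979, §1] -/
theorem claim_of_stableReach {m : ℕ} [NeZero m] {s : Multiset (ZMod m)} (hs0 : s ≠ 0)
    (hs : IsHodgeMultiset s) (h : StableReach[m, s]) : ClaimMultiset m s := by
  obtain ⟨k, hk, hreach⟩ := h
  haveI : NeZero (k * m) := ⟨Nat.mul_ne_zero hk.ne' (NeZero.ne m)⟩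
  have hL := levelChange hF m k hk s hs0 hs
  have hs0' : LevelRaise[k, m, s] ≠ 0 := by
    intro h0
    exact hs0 (Multiset.map_eq_zero.1 h0)
  exact hL.2.2 (claim_of_reach hF hs0' hL.1 hreach)

end Calculus

/-! ### The composition: claim for EVERY non-empty Hodge multiset, by strong induction on the length -/

/-- The statement of STUB A, as a hypothesis. -/
def StmtA : Prop :=
  ∀ (p m : ℕ) [NeZero m] (α : Fin (2 * p + 2) → ZMod m), 2 ≤ p → FermatCharacter.IsHodge α →
    ¬ FermatCharacter.IsDecomposable (Finset.univ.val.map α) →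
    ¬ FermatCharacter.IsQuasiDecomposable (Finset.univ.val.map α) →
    ¬ FermatCharacter.IsSemiDecomposable (Finset.univ.val.map α) →
    FermatCharacter.OnHodgeLine α →
      StableReach[m, Finset.univ.val.map α]

/-- The statement of STUB B, as a hypothesis. -/
def StmtB : Prop :=
  ∀ (p m : ℕ) [NeZero m] (α : Fin (2 * p + 2) → ZMod m), 2 ≤ p → FermatCharacter.IsHodge α →
    ¬ FermatCharacter.IsDecomposable (Finset.univ.val.map α) →
    ¬ FermatCharacter.IsQuasiDecomposable (Finset.univ.val.map α) →
    ¬ FermatCharacter.IsSemiDecomposable (Finset.univ.val.map α) →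
    ¬ FermatCharacter.OnHodgeLine α →
    ¬ StableReach[m, Finset.univ.val.map α] →
      EigenlineAlgebraic p m α

/-- **Claim for every non-empty Hodge multiset of every level, from S0 + A + B.** Strong induction on
the cardinality (the shape of the tree's `IsShiodaClosed.of_shiodaConditionUpTo`, with the fourth
alternative "`(P)`-irreducible" supplied by A/B instead of being excluded by `(Pₘ)`): `#s = 2` pairs
(dimension `0`); `#s = 4` the surface fact; decomposable `s = t + u` — lattice criterion with
`P = {t, u}`, `N = ∅` and the induction hypothesis (at `t`, `u` and at their negations, all shorter);
quasi-decomposable `s + {e,−e} = t + u` — either `e, −e` fall in the same part and `s` is decomposable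
after all, or `t = e ∷ t'`, `u = −e ∷ u'` both have `4 ≤ # < #s` and the criterion applies with
`P = {t, u}`, `N = {{e,−e}}`; semi-decomposable — the fact; `(P)`-irreducible — realise `s` by a Hodge
character `α` of some `X²ᵃₘ`, `a ≥ 2`: on a Hodge line ⟹ A ⟹ stably reachable ⟹ claimed; isolated
and stably reachable ⟹ claimed; isolated residual ⟹ B. [cite: Shioda1979PJA, §2 Thm. 1 and §4]
[cite: daSilva2021HodgeFermat, Cor. 2.3 and Thm. 2.5] [cite: Aoki1987, Thm. 1-4 (i), (ii)] -/
theorem claimMultiset_of_stubs (hF : Facts) (hA : StmtA) (hB : StmtB) :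
    ∀ (m : ℕ) [NeZero m] (s : Multiset (ZMod m)), s ≠ 0 → IsHodgeMultiset s → ClaimMultiset m s := by
  intro m _
  -- strong induction on the cardinality
  suffices H : ∀ k, ∀ s : Multiset (ZMod m), Multiset.card s = k → s ≠ 0 → IsHodgeMultiset s →
      ClaimMultiset m s from fun s ↦ H _ s rfl
  intro k
  induction k using Nat.strong_induction_on with
  | _ k ih =>
  intro s hk hs0 hs
  -- shorter non-empty Hodge multisets are claimed together with their negations (membership in `D`)
  have memD : ∀ t : Multiset (ZMod m), t ≠ 0 → IsHodgeMultiset t → Multiset.card t < Multiset.card s →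
      t ≠ 0 ∧ IsHodgeMultiset t ∧ ClaimMultiset m t ∧ ClaimMultiset m (t.map fun a ↦ -a) := by
    intro t ht0 ht hlt
    refine ⟨ht0, ht, ih _ (hk ▸ hlt) t rfl ht0 ht, ih _ ?_ _ rfl ?_ (latticeCriterion_isHodgeMultiset_map_neg ht)⟩
    · rw [Multiset.card_map]; exact hk ▸ hlt
    · intro h0; exact ht0 (Multiset.map_eq_zero.1 h0)
  -- the pair `{e, -e}`, `e ≠ 0`, is in `D`
  have pairD : ∀ e : ZMod m, e ≠ 0 →
      ({e, -e} : Multiset (ZMod m)) ≠ 0 ∧ IsHodgeMultiset ({e, -e} : Multiset (ZMod m)) ∧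
        ClaimMultiset m {e, -e} ∧ ClaimMultiset m (({e, -e} : Multiset (ZMod m)).map fun a ↦ -a) := by
    intro e he
    refine ⟨by simp [Multiset.insert_eq_cons], IsHodgeMultiset.pair he, ClaimMultiset.pair e, ?_⟩
    have hneg : (({e, -e} : Multiset (ZMod m)).map fun a ↦ -a) = {-e, -(-e)} := by
      simp [Multiset.insert_eq_cons]
    rw [hneg]
    exact ClaimMultiset.pair (-e)
  -- the quasi-decomposable case with `e ∈ t`, as a lemma applied twice (symmetry `t ↔ u`)
  have quasi : ∀ (e : ZMod m) (t u : Multiset (ZMod m)), t ≠ 0 → u ≠ 0 → IsHodgeMultiset t →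
      IsHodgeMultiset u → t ≠ s → u ≠ s → s + {e, -e} = t + u → e ∈ t → ClaimMultiset m s := by
    intro e t u ht0 hu0 ht hu hts hus hstu het
    have he : e ≠ 0 := ht.1.1 e het
    obtain ⟨t', rfl⟩ := Multiset.exists_cons_of_mem het
    -- cancel `e`: `-e ::ₘ s = t' + u`
    have h1 : (-e) ::ₘ s = t' + u := by
      rw [add_comm, pair_add_eq_cons_cons, Multiset.cons_add] at hstu
      exact (Multiset.cons_inj_right e).1 hstu
    have hne : -e ∈ t' + u := by rw [← h1]; exact Multiset.mem_cons_self _ _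
    rcases Multiset.mem_add.1 hne with h2 | h2
    · -- `e, -e ∈ t`: `t = {e,-e} + t''`, `s = t'' + u` is decomposable after all
      obtain ⟨t'', rfl⟩ := Multiset.exists_cons_of_mem h2
      have h3 : s = t'' + u := by
        rw [Multiset.cons_add] at h1
        exact (Multiset.cons_inj_right _).1 h1
      have ht'' : IsHodgeMultiset t'' := by
        rw [← pair_add_eq_cons_cons] at ht
        exact ht.of_pair_add
      have ht''0 : t'' ≠ 0 := by
        rintro rfl
        rw [zero_add] at h3
        exact hus h3.symm
      have hct : Multiset.card t'' < Multiset.card s := by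
        rw [h3, Multiset.card_add]
        have := hu.two_le_card hu0
        omega
      have hcu : Multiset.card u < Multiset.card s := by
        rw [h3, Multiset.card_add]
        have := ht''.two_le_card ht''0
        omega
      refine claim_of_rel hF hs0 hs {t'', u} 0 ?_ (fun u hu ↦ absurd hu (Multiset.notMem_zero u)) ?_
      · intro x hx
        simp only [Multiset.insert_eq_cons, Multiset.mem_cons, Multiset.mem_singleton] at hx
        rcases hx with rfl | rfl
        · exact memD _ ht''0 ht'' hct
        · exact memD _ hu0 hu hcu
      · rw [Multiset.sum_zero, add_zero, h3]
        simp [Multiset.insert_eq_cons]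
    · -- `e ∈ t`, `-e ∈ u`: both parts have `4 ≤ # < #s`, criterion with `N = {{e,-e}}`
      obtain ⟨u', rfl⟩ := Multiset.exists_cons_of_mem h2
      have h3 : s = t' + u' := by
        rw [Multiset.add_cons] at h1
        exact (Multiset.cons_inj_right _).1 h1
      have hcu4 : 4 ≤ Multiset.card ((-e) ::ₘ u') := by
        obtain ⟨j, hj⟩ := hu.even_card
        by_contra hlt
        have hu2 : Multiset.card ((-e) ::ₘ u') = 2 := by
          have := hu.two_le_card hu0
          omega
        apply hts
        have hsum : ((-e) ::ₘ u').sum = 0 := hu.1.2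
        rw [Multiset.card_cons] at hu2
        obtain ⟨b, hb⟩ := Multiset.card_eq_one.1 (by omega : Multiset.card u' = 1)
        rw [hb, Multiset.sum_cons, Multiset.sum_singleton, neg_add_eq_zero] at hsum
        subst hsum
        rw [hb] at hstu
        change s + {e, -e} = e ::ₘ t' + {-e, e} at hstu
        rw [Multiset.pair_comm (-e) e] at hstu
        exact (add_right_cancel hstu).symm
      have hct4 : 4 ≤ Multiset.card (e ::ₘ t') := by
        obtain ⟨j, hj⟩ := ht.even_card
        by_contra hlt
        have ht2 : Multiset.card (e ::ₘ t') = 2 := by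
          have := ht.two_le_card ht0
          omega
        apply hus
        have hsum : (e ::ₘ t').sum = 0 := ht.1.2
        rw [Multiset.card_cons] at ht2
        obtain ⟨b, hb⟩ := Multiset.card_eq_one.1 (by omega : Multiset.card t' = 1)
        rw [hb, Multiset.sum_cons, Multiset.sum_singleton, add_eq_zero_iff_eq_neg'] at hsum
        subst hsum
        rw [hb] at hstu
        change s + {e, -e} = {e, -e} + ((-e) ::ₘ u') at hstu
        rw [add_comm ({e, -e} : Multiset (ZMod m))] at hstu
        exact (add_right_cancel hstu).symm
      have hcards : Multiset.card (e ::ₘ t') + Multiset.card ((-e) ::ₘ u') = Multiset.card s + 2 := by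
        rw [h3, Multiset.card_cons, Multiset.card_cons, Multiset.card_add]; ring
      have hct : Multiset.card (e ::ₘ t') < Multiset.card s := by omega
      have hcu : Multiset.card ((-e) ::ₘ u') < Multiset.card s := by omega
      refine claim_of_rel hF hs0 hs {e ::ₘ t', (-e) ::ₘ u'} {({e, -e} : Multiset (ZMod m))} ?_ ?_ ?_
      · intro x hx
        simp only [Multiset.insert_eq_cons, Multiset.mem_cons, Multiset.mem_singleton] at hx
        rcases hx with rfl | rfl
        · exact memD _ (Multiset.cons_ne_zero) ht hct
        · exact memD _ (Multiset.cons_ne_zero) hu hcu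
      · intro x hx
        rw [Multiset.mem_singleton] at hx
        subst hx
        exact pairD e he
      · rw [Multiset.sum_singleton, hstu]
        simp [Multiset.insert_eq_cons]
  -- case distinction on the cardinality
  obtain ⟨j, hj⟩ := hs.even_card
  have h2 := hs.two_le_card hs0
  rcases Nat.lt_or_ge (Multiset.card s) 6 with hlt | h6
  · rcases Nat.lt_or_ge (Multiset.card s) 4 with hlt4 | h4
    · -- `#s = 2`: a pair, dimension `0`
      obtain ⟨a, ha, rfl⟩ := hs.eq_pair_of_card_eq_two (by omega)
      exact ClaimMultiset.pair a
    · -- `#s = 4`: the Fermat surface (Aoki–Shioda (2.1))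
      exact ClaimMultiset.surface_of_claim_one (fun α hα ↦ hF.2.2.2.1 m α hα) hs (by omega)
  by_cases hdec : IsDecomposable s
  · -- decomposable: `P = {t, u}`, `N = ∅`
    obtain ⟨t, u, ht0, hu0, ht, hu, rfl⟩ := hdec
    have hct : Multiset.card t < Multiset.card (t + u) := by
      rw [Multiset.card_add]; have := hu.two_le_card hu0; omega
    have hcu : Multiset.card u < Multiset.card (t + u) := by
      rw [Multiset.card_add]; have := ht.two_le_card ht0; omega
    refine claim_of_rel hF hs0 hs {t, u} 0 ?_ (fun u hu ↦ absurd hu (Multiset.notMem_zero u)) ?_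
    · intro x hx
      simp only [Multiset.insert_eq_cons, Multiset.mem_cons, Multiset.mem_singleton] at hx
      rcases hx with rfl | rfl
      · exact memD _ ht0 ht hct
      · exact memD _ hu0 hu hcu
    · simp [Multiset.insert_eq_cons]
  by_cases hquasi : IsQuasiDecomposable s
  · obtain ⟨e, -, t, u, ht0, hu0, ht, hu, hts, hus, hstu⟩ := hquasi
    have he : e ∈ t + u := by rw [← hstu]; simp
    rcases Multiset.mem_add.1 he with het | heu
    · exact quasi e t u ht0 hu0 ht hu hts hus hstu het
    · exact quasi e u t hu0 ht0 hu ht hus hts (hstu.trans (add_comm t u)) heu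
  by_cases hsemi : IsSemiDecomposable s
  · -- semi-decomposable: Shioda's type-II supply (the fact, multiset form)
    exact Shioda1979_claim_semiDecomposable_iff_multiset.1 hF.2.2.2.2.1 m s hs hsemi
  -- `(P)`-irreducible, `#s ≥ 6`: realise `s` by a Hodge character of some `X²ᵃₘ`, `a ≥ 2`
  obtain ⟨a, α, hα, rfl⟩ := hs.exists_isHodge_even hs0
  have ha : 2 ≤ a := by rw [card_univ_val_map] at h6; omega
  by_cases hline : OnHodgeLine α
  · -- on a Hodge line: STUB A, then the landed calculus
    exact claim_of_stableReach hF hs0 hs (hA a m α ha hα hdec hquasi hsemi hline)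
  · by_cases hreach : StableReach[m, Finset.univ.val.map α]
    · exact claim_of_stableReach hF hs0 hs hreach
    · -- the residual sporadic class: STUB B
      exact (claimMultiset_univ_val_map_iff α).2
        (eigenlineAlgebraic_iff_claim.1 (hB a m α ha hα hdec hquasi hsemi hline hreach))

/-- **THE LINE'S COMPOSITION, statement form** (kernel-checked, no `sorry`, no stub used): S0-facts →
STUB A → STUB B → the crux UNFOLDED (`cosetAlgebraicity_iff` is `Iff.rfl`; the conclusion is kept
unfolded so that exactly ONE theorem of this file, `CosetAlgebraicity_of` below, has the crux decl as
its syntactic conclusion — the skeleton audit takes the first such theorem). The on-line indecomposable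
`α` of the crux is a non-empty Hodge multiset up to order; `claimMultiset_of_stubs` claims it; the
bridge `eigInline_iff` turns claim(`α`) into the inline clause. [cite: Shioda1979PJA, §2 Thm. 1]
[cite: Aoki1987, Thm. 1-4] -/
theorem cosetAlgebraicity_of_hyps (hF : Facts) (hA : StmtA) (hB : StmtB) :
    ∀ (p m : ℕ) [NeZero m] (α : Fin (2 * p + 2) → ZMod m), 2 ≤ p → IsHodge α →
      ¬ IsDecomposable (univ.val.map α) → OnHodgeLine α → EigenlineAlgebraic p m α := by
  intro p m _ α _ hα _ _
  have hall := claimMultiset_of_stubs hF hA hB m (Finset.univ.val.map α) ?_ hα.isHodgeMultiset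
  · exact eigenlineAlgebraic_iff_claim.2 ((claimMultiset_univ_val_map_iff α).1 hall)
  · intro h0
    have := congrArg Multiset.card h0
    rw [card_univ_val_map, Multiset.card_zero] at this
    omega

/-- **THE LINE'S COMPOSITION: the crux BY NAME, closed modulo exactly the three registered stubs**
(`sorryAx` reaches it only through `stub_printedFacts`, `stub_irreducibleOnLine_stableReach`,
`stub_irreducibleIsolated_residual`; the statements of the stubs are by `rfl` the hypotheses `Facts`,
`StmtA`, `StmtB` of the sorry-free `cosetAlgebraicity_of_hyps`). [cite: Shioda1979PJA, §2 Thm. 1]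
[cite: Aoki1987, Thm. 1-4] -/
theorem CosetAlgebraicity_of :
    Summit.HodgeConjecture.HodgeConjecture.Theses.GaloisSieve.CosetAlgebraicity :=
  cosetAlgebraicity_of_hyps stub_printedFacts stub_irreducibleOnLine_stableReach
    stub_irreducibleIsolated_residual

/-! ### By-products: what the stubs buy beyond the crux, and what the route already pays for -/

/-- **STUB B is a sub-family of the route's rank-3 crux `SporadicAlgebraicity`** (one line: the extra
hypotheses `¬ quasi`, `¬ semi`, `¬ StableReach` are simply dropped). Hence
`CosetAlgebraicity ⇐ SporadicAlgebraicity + STUB A + S0` (`cosetAlgebraicity_of_sporadic`). [folklore] -/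
theorem stubB_of_sporadicAlgebraicity (hS : SporadicAlgebraicity) : StmtB :=
  fun p m _ α hp hα hdec _ _ hline _ ↦ hS p m α hp hα hdec hline

/-- **The rank-2 crux from the rank-3 crux, the arithmetic STUB A and the printed facts.**
[cite: Aoki1987, Thm. 1-4] [cite: Shioda1979PJA, §2 Thm. 1] -/
theorem cosetAlgebraicity_of_sporadic (hF : Facts) (hA : StmtA) (hS : SporadicAlgebraicity) :
    ∀ (p m : ℕ) [NeZero m] (α : Fin (2 * p + 2) → ZMod m), 2 ≤ p → IsHodge α →
      ¬ IsDecomposable (univ.val.map α) → OnHodgeLine α → EigenlineAlgebraic p m α :=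
  cosetAlgebraicity_of_hyps hF hA (stubB_of_sporadicAlgebraicity hS)

/-- **The route's TARGET `HodgeEigenlines` from the same three stubs** (every Hodge eigenline of every
Fermat `2p`-fold, `p ≥ 1`): the induction claims every non-empty Hodge multiset.
[cite: Shioda1979PJA, §2 Thm. 1] [cite: Aoki1987, Thm. 1-4] -/
theorem hodgeEigenlines_of_stubs (hF : Facts) (hA : StmtA) (hB : StmtB) : HodgeEigenlines := by
  intro p m _ α hp hα
  have hall := claimMultiset_of_stubs hF hA hB m (Finset.univ.val.map α) ?_ hα.isHodgeMultiset
  · exact eigenlineAlgebraic_iff_claim.2 ((claimMultiset_univ_val_map_iff α).1 hall)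
  · intro h0
    have := congrArg Multiset.card h0
    rw [card_univ_val_map, Multiset.card_zero] at this
    omega

/-- **`birth`'s load-bearing STUB 3 (`(P)`-irreducible on a line ⇒ algebraic) follows from STUB A and
the printed facts alone** — the transfer in one line: stably reachable ⇒ claimed. [cite: Aoki1987, Thm. 1-4] -/
theorem birthStub3_of_stubs (hF : Facts) (hA : StmtA) :
    ∀ (p m : ℕ) [NeZero m] (α : Fin (2 * p + 2) → ZMod m), 2 ≤ p → FermatCharacter.IsHodge α →
      ¬ FermatCharacter.IsDecomposable (Finset.univ.val.map α) →
      ¬ FermatCharacter.IsQuasiDecomposable (Finset.univ.val.map α) →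
      ¬ FermatCharacter.IsSemiDecomposable (Finset.univ.val.map α) →
      FermatCharacter.OnHodgeLine α → EigenlineAlgebraic p m α := by
  intro p m _ α hp hα hdec hquasi hsemi hline
  have h0 : Finset.univ.val.map α ≠ 0 := by
    intro h0
    have := congrArg Multiset.card h0
    rw [card_univ_val_map, Multiset.card_zero] at this
    omega
  exact eigenlineAlgebraic_iff_claim.2 ((claimMultiset_univ_val_map_iff α).1
    (claim_of_stableReach hF h0 hα.isHodgeMultiset (hA p m α hp hα hdec hquasi hsemi hline)))

/-! ### Sanity: the vocabulary computes on the decisive instances (kernel `decide`) -/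

/-- `gap₃₅ = (1,2,16,17,21,22,30,31)`, the first residual sign class (`X⁶₃₅`), IS a Hodge multiset of
`ℤ/35`. [cite: Aoki2002, Ex. 8.6] -/
example : IsHodgeMultiset ({1, 2, 16, 17, 21, 22, 30, 31} : Multiset (ZMod 35)) := by
  unfold IsHodgeMultiset mNormSum; decide

/-- … and it is NOT semi-decomposable (it has `8` elements). [folklore] -/
example : ¬ IsSemiDecomposable ({1, 2, 16, 17, 21, 22, 30, 31} : Multiset (ZMod 35)) := by
  rintro ⟨t, u, ht, hu, -, -, h⟩
  have := congrArg Multiset.card h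
  rw [Multiset.card_add, ht, hu] at this
  simp at this

end Summit.HodgeConjecture.HodgeConjecture.Cruxes.CosetAlgebraicity.StableReachRecut

end
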